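import Literature.Computability.Cryptography.CubicClassSamplingLawParts
import Literature.Computability.Cryptography.CubicClassSamplingSpecs
import Literature.Computability.Cryptography.CubicClassTableFPLadder
import Literature.Computability.Cryptography.CubicClassPostProgFP
import Literature.Computability.Cryptography.CubicClassPostLabels
import Literature.Computability.Cryptography.CubicClassPostPairLaw
import Literature.Computability.Cryptography.CubicClassPostRows
import Literature.Computability.Cryptography.PeriodFindingIndependence
import Literature.Computability.Cryptography.HallgrenClassGroupQuantumSuccess
import Literature.Computability.QuantumComplexity.QuantumTuring
import HarnessLib

/-!
# The pure-cubic class-group sampling claims `ClaimSamplingLaw`, `ClaimTableFP`, `ClaimPost` HOLD (re-homed proofs)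

**Three registered claims of the pure-cubic class-group sampling analysis HOLD** — the named facts
`Literature.Computability.Cryptography.CubicClassSampling.ClaimSamplingLaw` (P6, the per-unit Fourier sampling law of a shift-cell /
coset table: the character law is within `2^-e₆` in total variation of the idealised weight `w₁ c = corrMass Q F₁ c / Q²`, and `w₁`
satisfies `UnitSamplingLaw`), `…CubicClassSampling.ClaimTableFP` (the class-table oracle and the capped post-processor are `CodeFP`
programs with the stated argument conventions) and `…CubicClassSampling.ClaimPost` (P7, the capped post-processor on `2n` independent
unit outcomes returns the index `[ℤ^T : Λ]` with the displayed probability), all three stated in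
`Literature/Computability/Cryptography/CubicClassSamplingSpecs.lean` after Hallgren, *Fast quantum algorithms for computing the unit
group and class group of a number field*, STOC 2005, §4 [Hallgren2005] (with Kitaev 1995 §4 and Cheung–Mosca 2001 §3 for the
period-finding / post-processing layers).  The in-tree proofs are assemblies of the tree's Literature bricks: `CubicClassSamplingLawParts`
(`samplingLaw_tv`, `samplingLaw_inaccurate`, `samplingLaw_uniform`) for P6; `CubicClassTableFPLadder` / `CubicClassPostProgFP` for the
`CodeFP` claims; `CubicClassPostLabels` / `CubicClassPostPairLaw` / `CubicClassPostRows` / `PeriodFindingIndependence` /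
`HallgrenClassGroupQuantumSuccess` for P7 (pair law of two samples, disjoint pairs `pa`/`pb`, generation ⇒ correct output, success bound).
Kernel-checked; until now Summits-side only (`Summits/QuantumAdvantage/QuantumAdvantage/Theorems/LinnikCubicClassGroupsPureCubicClassGroupFBQPStubClass{SamplingLaw,TableProg,Post}.lean`).
RE-HOMED into `Literature/` by the Hodge foundations lane (`lit-hodgefound`, seat p20, generation 38): verbatim DECLARATION-LEVEL ports of
those 3 Summits modules (1 + 3 + 9 declarations; the helper definitions `pa`, `pb`, `lawOf` come with their bodies), namespace
`Summit.QuantumAdvantage.QuantumAdvantage.Theorems.LinnikCubicClassGroups` re-rooted as `Literature.Computability.Cryptography.CubicClassSampling.LinnikStubs`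
(in-tree `stub_…` names kept, they are proved theorems), followed by the three EXACT-name discharges `ClaimSamplingLaw_holds`,
`ClaimTableFP_holds`, `ClaimPost_holds` in `namespace Literature.Computability.Cryptography.CubicClassSampling`.  No new named fact (D-0026),
no Summits import; imports Literature `Computability/Cryptography/*` + Mathlib only.  The Summits originals stay in place (transitional
duplication).  WHAT THIS IS NOT: no claim about BQP vs BPP or about the number-theoretic stages (cubic-field facts, regulator bounds) of the route.
-/

noncomputable section

/-!
## Part 1 — port of `Summits/QuantumAdvantage/QuantumAdvantage/Theorems/LinnikCubicClassGroupsPureCubicClassGroupFBQPStubClassSamplingLaw.lean` (1 declarations kept)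

# Crux `LinnikCubicClassGroups.PureCubicClassGroupFBQP`  — stub `stub_classSamplingLaw` (S5b-P6)

Line `arakelov-giant-step-cycle`. **P6, the per-unit sampling law of a shift-cell / coset table** (`ClaimSamplingLaw`,
`Literature/Computability/Cryptography/CubicClassSamplingSpecs.lean`): Fourier sampling one unit of a table with the
structure `ShiftCellCosetTable` gives a character law within `2^-e₆` (total variation) of the weight
`w₁ c = corrMass Q F₁ c / Q²` of the IDEALISED table `F₁` (coins and defects ignored), and `w₁` satisfies `UnitSamplingLaw`
with the coupling `μ'_t = μ_t + 2^-s (2^ℓe)^-(T−t)`, accuracy `δ = 2u/2^ℓe`, inaccurate mass `≤ 2^-e₆` and near-uniformity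
`1/8`. Pure harmonic analysis, no number theory; the proof is assembled from the `PeriodFinding*` bricks
(`corrMass_shiftCell` factorisation, twisted class sums = jittered coset box sums, window energy of one coset per character,
dual angles, run-table tails) through `CubicClassSamplingLawParts` (`samplingLaw_tv`, `samplingLaw_inaccurate`,
`samplingLaw_uniform`). [Hallgren 2005, §4; Kitaev 1995, §4]

(Verbatim declaration-level port — the declarations listed in the Part header count — of the Summits-side module of the
QuantumAdvantage tree; route / stub bookkeeping in the text above is historical.)
-/

section Part1

namespace Literature.Computability.Cryptography.CubicClassSampling.LinnikStubs

open Literature.Computability.Cryptography.PeriodFinding (corrMass)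
open Literature.Computability.Cryptography.CubicClassSampling
open Literature.Computability.Cryptography

/-- (REGISTERED SIGNATURE — do not change.) **S5b-P6 `stub_classSamplingLaw`**: the per-unit law of Fourier sampling a shift-cell /
coset table (`ClaimSamplingLaw`, `Literature/Computability/Cryptography/CubicClassSamplingSpecs.lean`): witnesses
`μ'_t = μ_t + 2^-s (2^ℓe)^-(T−t)` and `w₁ = corrMass Q F₁ / Q²` for the idealised table `F₁`; total variation by
`samplingLaw_tv`, inaccurate mass by `samplingLaw_inaccurate`, near-uniformity by `samplingLaw_uniform`.
[cite: Hallgren2005, §4] -/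
theorem stub_classSamplingLaw : ClaimSamplingLaw := by
  intro T ℓe s ℓy ℓκ top Ncell hB u e₆ K₀ Ω _ F Λ _ F₀ cls σ C y μ Badκ D εκ εD hTab hT hs hℓκ hhB h1 hεκ hεD hε hu hM hN
    hKlo hKhi
  have hQ : 2 ^ (top + (ℓy - s) + s + ℓe * T) = (2 ^ ℓe) ^ T * (2 ^ s * 2 ^ (top + (ℓy - s))) := by
    rw [← pow_mul, ← pow_add, ← pow_add]; congr 1; ring
  have hQR : ((2 : ℝ) ^ (top + (ℓy - s) + s + ℓe * T)) = ((((2 ^ ℓe) ^ T * (2 ^ s * 2 ^ (top + (ℓy - s)))) : ℕ) : ℝ) := by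
    rw [← hQ]; push_cast; ring
  have hLq : 2 ^ CubicClassPost.PostParams.Lq ⟨T, ℓe, s, ℓy - s, top, K₀, hB⟩ =
      2 ^ (top + (ℓy - s)) * (2 ^ s * 2 ^ (ℓe * T)) := by
    show 2 ^ (top + (ℓy - s) + s + ℓe * T) = _
    rw [pow_add, pow_add, mul_assoc]
  have hδ : ((2 * u : ℝ) / 2 ^ ℓe) = 2 * (u : ℝ) / ((2 ^ ℓe : ℕ) : ℝ) := by push_cast; ring
  refine ⟨fun t => μ t + 1 / (((2 ^ s : ℕ) : ℝ) * ((2 ^ ℓe : ℕ) : ℝ) ^ (T - (t : ℕ))),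
    fun c => corrMass ((2 ^ ℓe) ^ T * (2 ^ s * 2 ^ (top + (ℓy - s))))
      (fun v => C (cls (v % (2 ^ ℓe) ^ T)) ((σ (v % (2 ^ ℓe) ^ T) + v / (2 ^ ℓe) ^ T) % 2 ^ s)) c /
      ((((2 ^ ℓe) ^ T * (2 ^ s * 2 ^ (top + (ℓy - s)))) : ℕ) : ℝ) ^ 2, ?_, ?_⟩
  · rw [hQ, hQR]
    exact samplingLaw_tv hTab hs hℓκ hε
  · unfold UnitSamplingLaw
    refine ⟨fun c => div_nonneg (PeriodFinding.corrMass_nonneg _ _ _) (sq_nonneg _), ?_, ?_⟩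
    · rw [hLq, hδ]
      exact samplingLaw_inaccurate hTab hT hhB h1 hu hM hN hKlo hKhi
    · intro kk ξ hξ
      rw [hLq, hδ]
      exact samplingLaw_uniform hTab hT hhB h1 hu hM hN hKlo hKhi kk ξ hξ

end Literature.Computability.Cryptography.CubicClassSampling.LinnikStubs

end Part1

/-!
## Part 2 — port of `Summits/QuantumAdvantage/QuantumAdvantage/Theorems/LinnikCubicClassGroupsPureCubicClassGroupFBQPStubClassTableProg.lean` (3 declarations kept)

# Crux `LinnikCubicClassGroups.PureCubicClassGroupFBQP`  — stub `stub_classTableProg` (S5b-P5a)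

Line `arakelov-giant-step-cycle`. The PROGRAMMING part of the class-group stage of Hallgren's class-number algorithm for
`ℚ(∛(ab²))`: the ladder class table `classTableOpQ` (`CubicClassTableLadder.lean`) and the capped post-processor
`PostParams.postOutC` (`CubicClassSamplingSpecs.lean`) are typed polynomial time (`ClaimTableFP`). No number theory: the
table is the pointwise `CodeFP` composition `WalkFns.codeFP_classTableOpQ` of `CubicClassTableFP{Kernel,Gens,Pow,Exp,Ladder}.lean`
(closure of polynomial time under composition and folds with a step-indexed size invariant, `CodeFPInvFolds.lean`), read off
the argument tuple `tableArgsE` (binary `a b m r margin cap v`, raw `ps`, the lattice code `ord`, unary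
`k prec s ℓe npp ℓy ℓκ ℓb s₀ Tdbl Bfin Bb`); the post-processor is `PostParams.codeFP_postOutCap` of `CubicClassPostProgFP.lean`
(decoding, reduced pairing, `roundB` by the continued-fraction scan of `CubicClassPostRoundFP.lean`, the rows, `lcmDen`, the
residue rows, `HowellFP.subgroupOrderPureC`, capped at the denominator bound) read off `postArgsE`.

(Verbatim declaration-level port — the declarations listed in the Part header count — of the Summits-side module of the
QuantumAdvantage tree; route / stub bookkeeping in the text above is historical.)
-/

section Part2

namespace Literature.Computability.Cryptography.CubicClassSampling.LinnikStubs

open Literature.Computability.Complexity (CodeFP)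
open Literature.Computability.Complexity.CodeFP (pairE strE natE intE unE rawE fst snd)
open Literature.Computability.Cryptography (CubicClassTable.WalkFns)
open Literature.Computability.Cryptography.CubicClassSampling
open Literature.Computability.Cryptography.CubicClassPost (PostParams.codeFP_postOutCap)

/-- **The ladder class table on its argument tuple is computed on codes**: every field of the instance, the cap and the
position are projections of the tuple code `tableArgsE`, so `WalkFns.codeFP_classTableOpQ` applies with the context
`TableArgs`. [cite: Hallgren2005, §4] -/
theorem codeFP_classTableOpQ_args (Fw : CubicClassTable.WalkFns)
    (hroots : CodeFP (pairE natE (pairE natE strE)) (rawE natE) Fw.roots)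
    (hprime : CodeFP (pairE (pairE natE natE) (pairE (pairE natE (rawE intE)) (pairE natE natE))) (pairE natE (rawE intE)) Fw.primeL)
    (hlat : CodeFP (pairE (pairE natE natE) (pairE (pairE natE (rawE intE)) (pairE natE (rawE intE)))) (pairE natE (rawE intE)) Fw.latProd)
    (hred : CodeFP (pairE (pairE (pairE natE natE) unE) (pairE natE (rawE intE))) (pairE (pairE natE (rawE intE)) intE) Fw.redL)
    (hlat6 : ∀ x, (Fw.latProd x).2.length ≤ 6) (hred6 : ∀ x, ((Fw.redL x).1).2.length ≤ 6) :
    CodeFP tableArgsE (pairE (pairE natE (rawE intE)) natE) (fun q : TableArgs => Fw.classTableOpQ (instOfArgs q) q.2.1 q.2.2) := by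
  -- the tuple of the instance fields and its successive tails
  have h1 : CodeFP tableArgsE (pairE natE (pairE natE (pairE natE (pairE (rawE natE) (pairE (pairE natE (rawE intE)) (pairE natE (pairE unE
      (pairE unE (pairE unE (pairE unE (pairE unE (pairE unE (pairE unE (pairE unE (pairE unE (pairE unE (pairE unE
      (pairE unE natE)))))))))))))))))) (fun q : TableArgs => q.1) := fst _ _
  have t1 := h1.snd'
  have t2 := t1.snd'
  have t3 := t2.snd'
  have t4 := t3.snd'
  have t5 := t4.snd'
  have t6 := t5.snd'
  have t7 := t6.snd'
  have t8 := t7.snd'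
  have t9 := t8.snd'
  have t10 := t9.snd'
  have t11 := t10.snd'
  have t12 := t11.snd'
  have t13 := t12.snd'
  have t14 := t13.snd'
  have t15 := t14.snd'
  have t16 := t15.snd'
  have t17 := t16.snd'
  have ha : CodeFP tableArgsE natE (fun q : TableArgs => (instOfArgs q).a) := h1.fst'
  have hb : CodeFP tableArgsE natE (fun q : TableArgs => (instOfArgs q).b) := t1.fst'
  have hm : CodeFP tableArgsE natE (fun q : TableArgs => (instOfArgs q).m) := t2.fst'
  have hps : CodeFP tableArgsE (rawE natE) (fun q : TableArgs => (instOfArgs q).ps) := t3.fst'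
  have hord : CodeFP tableArgsE (pairE natE (rawE intE)) (fun q : TableArgs => (instOfArgs q).ord) := t4.fst'
  have hr : CodeFP tableArgsE natE (fun q : TableArgs => (instOfArgs q).r) := t5.fst'
  have hk : CodeFP tableArgsE unE (fun q : TableArgs => (instOfArgs q).k) := t6.fst'
  have hprec : CodeFP tableArgsE unE (fun q : TableArgs => (instOfArgs q).prec) := t7.fst'
  have hs : CodeFP tableArgsE unE (fun q : TableArgs => (instOfArgs q).s) := t8.fst'
  have hℓe : CodeFP tableArgsE unE (fun q : TableArgs => (instOfArgs q).ℓe) := t9.fst'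
  have hnpp : CodeFP tableArgsE unE (fun q : TableArgs => (instOfArgs q).npp) := t10.fst'
  have hℓy : CodeFP tableArgsE unE (fun q : TableArgs => (instOfArgs q).ℓy) := t11.fst'
  have hℓκ : CodeFP tableArgsE unE (fun q : TableArgs => (instOfArgs q).ℓκ) := t12.fst'
  have hℓb : CodeFP tableArgsE unE (fun q : TableArgs => (instOfArgs q).ℓb) := t13.fst'
  have hs₀ : CodeFP tableArgsE unE (fun q : TableArgs => (instOfArgs q).s₀) := t14.fst'
  have hTdbl : CodeFP tableArgsE unE (fun q : TableArgs => (instOfArgs q).Tdbl) := t15.fst'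
  have hBb : CodeFP tableArgsE unE (fun q : TableArgs => (instOfArgs q).Bb) := t17.fst'
  have hmargin : CodeFP tableArgsE natE (fun q : TableArgs => (instOfArgs q).margin) := t17.snd'
  have hcap : CodeFP tableArgsE natE (fun q : TableArgs => q.2.1) := (snd _ _).fst'
  have hv : CodeFP tableArgsE natE (fun q : TableArgs => q.2.2) := (snd _ _).snd'
  exact Fw.codeFP_classTableOpQ (σ := TableArgs) (eσ := tableArgsE) (I := instOfArgs) (cap := fun q => q.2.1) (v := fun q => q.2.2)
    hroots hprime hlat hred hlat6 hred6 ha hb hm hps hord hr hk hprec hs hℓe hnpp hℓy hℓκ hℓb hs₀ hTdbl hBb hmargin hcap hv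

/-- **The capped post-processor on its argument tuple is computed on codes** (`PostParams.codeFP_postOutCap` with the
context `PostArgs`; `postOutC` unfolds to the capped form). [cite: Hallgren2005, §4] -/
theorem codeFP_postOutC_args : CodeFP postArgsE natE (fun q : PostArgs => (postOfArgs q).postOutC q.2) := by
  have h1 : CodeFP postArgsE (pairE unE (pairE unE (pairE unE (pairE unE (pairE unE (pairE natE natE)))))) (fun q : PostArgs => q.1) := fst _ _
  have t1 := h1.snd'
  have t2 := t1.snd'
  have t3 := t2.snd'
  have t4 := t3.snd'
  have t5 := t4.snd'
  have hT : CodeFP postArgsE unE (fun q : PostArgs => (postOfArgs q).T) := h1.fst'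
  have hℓe : CodeFP postArgsE unE (fun q : PostArgs => (postOfArgs q).ℓe) := t1.fst'
  have hs : CodeFP postArgsE unE (fun q : PostArgs => (postOfArgs q).s) := t2.fst'
  have haexp : CodeFP postArgsE unE (fun q : PostArgs => (postOfArgs q).aexp) := t3.fst'
  have htop : CodeFP postArgsE unE (fun q : PostArgs => (postOfArgs q).top) := t4.fst'
  have hK₀ : CodeFP postArgsE natE (fun q : PostArgs => (postOfArgs q).K₀) := t5.fst'
  have hB : CodeFP postArgsE natE (fun q : PostArgs => (postOfArgs q).B) := t5.snd'
  have hcs : CodeFP postArgsE (rawE natE) (fun q : PostArgs => q.2) := snd _ _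
  exact (PostParams.codeFP_postOutCap (σ := PostArgs) (eσ := postArgsE) (P := postOfArgs) (cs := fun q => q.2)
    hT hℓe hs haexp htop hK₀ hB hcs).congr fun q => rfl

/-- (REGISTERED SIGNATURE — do not change.) **S5b-P5a `stub_classTableProg`**: the ladder class table and the capped
post-processor are typed polynomial time (`ClaimTableFP`, `Literature/Computability/Cryptography/CubicClassSamplingSpecs.lean`).
[cite: Hallgren2005, §4] -/
theorem stub_classTableProg : ClaimTableFP :=
  ⟨fun Fw hroots hprime hlat hred hlat6 hred6 => codeFP_classTableOpQ_args Fw hroots hprime hlat hred hlat6 hred6,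
    codeFP_postOutC_args⟩

end Literature.Computability.Cryptography.CubicClassSampling.LinnikStubs

end Part2

/-!
## Part 3 — port of `Summits/QuantumAdvantage/QuantumAdvantage/Theorems/LinnikCubicClassGroupsPureCubicClassGroupFBQPStubClassPost.lean` (9 declarations kept)

# Crux `LinnikCubicClassGroups.PureCubicClassGroupFBQP`  — stub `stub_classPost` (S5b-P7)

Line `arakelov-giant-step-cycle`. **P7: the exact-modes / coprime-pairing post-processing succeeds** (`CubicClassSampling.ClaimPost`):
`2n` independent Fourier-sampling units with law `w`, `ℓ¹`-close (`ε₃`) to a weight `w₁` obeying `UnitSamplingLaw` (inaccurate mass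
`ε₁`, near-uniformity `ε₂` of the character given the residue), accuracy `δ` with `(4K₀+2) δ B² < 1` and `[ℤ^T : Λ] ≤ B`; then the
capped post-processor returns `[ℤ^T : Λ]` with probability `≥ 1 − 2n(ε₁+ε₃) − (B+1)^(log₂ B + 2) ((1+ε₂)²/2 + 3(ε₁+ε₃))^n`.

Proof (finite probability + finite abelian groups; the bricks are Literature files landed for this stub):
* the dual group `Λ^*/ℤ^T` is the annihilator `G = annih h Λ ≤ (ℤ/h)^T`, `|G| = h = [ℤ^T : Λ]` (`CubicClassPostDual`); an accurate
  outcome `c` carries a residue `klab c` and ONE character with group label `glab c ∈ G`, and on an accurate pair the reduced row is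
  EXACTLY the representative of `sG c c' = c₁ glab c + c₂ glab c' ∈ G` plus integers (`CubicClassPostLabels`,
  `CubicClassPostRecover`), so when all units are accurate and these combinations generate `G` the capped post-processor returns
  `|G| = h` (`postOutC_eq_of_generate`, via `CubicClassPostRows.subgroupOrderPure_natRows_eq_card`);
* failure ⊆ {some unit inaccurate} ∪ ⋃_{H < G} {every pair accurate with combination in `H`}: the first has probability
  `≤ 2n (ε₁ + ε₃)`, each of the `≤ (h+1)^{log₂ h}` events of the second has probability `≤ ((1+ε₂)²/2 · (1+ε₃)²)^n`
  (`CubicClassPostPairLaw.sum_pair_event_le`, product law `PeriodFinding.prob_forall_not_eq_prod`), and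
  `(1+ε₂)²/2 (1+ε₃)² ≤ (1+ε₂)²/2 + 3(ε₁+ε₃)` unless the claimed bound is `≤ 0`.

(Verbatim declaration-level port — the declarations listed in the Part header count — of the Summits-side module of the
QuantumAdvantage tree; route / stub bookkeeping in the text above is historical.)
-/

section Part3

open scoped _root_.Classical

namespace Literature.Computability.Cryptography.CubicClassSampling.LinnikStubs

open Literature.Computability.Cryptography
open Literature.Computability.Cryptography.CubicClassSampling
open Literature.Computability.Cryptography.CubicClassPost
open _root_.Finset

/-! ### Correctness on the good event -/

section Correct

variable {P : PostParams} {Λ : AddSubgroup (Fin P.T → ℤ)} [Λ.FiniteIndex] {μ' : Fin P.T → ℝ} {δ : ℝ} {h : ℕ} [NeZero h]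
  {n : ℕ}

/-- The first unit of pair `i`. [cite: Hallgren2005, §4; Kitaev1995, §4] -/
def pa (n : ℕ) (i : Fin n) : Fin (2 * n) := ⟨2 * i, by omega⟩

/-- The second unit of pair `i`. [cite: Hallgren2005, §4; Kitaev1995, §4] -/
def pb (n : ℕ) (i : Fin n) : Fin (2 * n) := ⟨2 * i + 1, by omega⟩

omit [Λ.FiniteIndex] [NeZero h] in
/-- The pairs are disjoint. [cite: Hallgren2005, §4; Kitaev1995, §4] -/
theorem disjointPairs_pa_pb (n : ℕ) : PeriodFinding.DisjointPairs (pa n) (pb n) where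
  inj_a i j hij := by have := congrArg Fin.val hij; simp only [pa] at this; exact Fin.ext (by omega)
  inj_b i j hij := by have := congrArg Fin.val hij; simp only [pb] at this; exact Fin.ext (by omega)
  a_ne_b i j hij := by have := congrArg Fin.val hij; simp only [pa, pb] at this; omega

/-- **Correctness on the good event**: if all `2n` outcomes are accurate and the combined group elements of the `n` pairs
generate `annih h Λ`, the capped post-processor returns `h = [ℤ^T : Λ]`. [cite: Hallgren2005, §4; CheungMosca2001, §3] -/
theorem postOutC_eq_of_generate (hh : Λ.index = h) (hhB : h ≤ P.B) (hδ : 0 ≤ δ)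
    (hδK : (4 * (P.K₀ : ℝ) + 2) * δ * (P.B : ℝ) ^ 2 < 1) {Q : ℕ} (cs : Fin (2 * n) → Fin Q)
    (hacc : ∀ u, (cs u : ℕ) ∈ AccAll P Λ μ' δ)
    (hgen : AddSubgroup.closure (Set.range fun i : Fin n => sG P Λ μ' δ hh (cs (pa n i)) (cs (pb n i))) = ⊤) :
    P.postOutC (List.ofFn fun u => ((cs u : ℕ))) = h := by
  -- the rows
  set rows : Fin n → ℕ → ℚ := fun i => P.deriveR (dec P (cs (pa n i))) (dec P (cs (pb n i))) with hrows
  set s : Fin n → Fin P.T → ZMod h := fun i => ((sG P Λ μ' δ hh (cs (pa n i)) (cs (pb n i)) : annih h Λ) : Fin P.T → ZMod h)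
    with hs
  have hdec : ∀ j, P.decodeUnit (cs j : ℕ) = some (dec P (cs j : ℕ)) := fun j =>
    (decodeUnit_of_mem_Acc (xiOf_spec (hacc j)).2).1
  have hpr : P.pairRowsR (List.ofFn fun u => ((cs u : ℕ))) = List.ofFn fun i => (List.range P.T).map (rows i) :=
    pairRowsR_ofFn P (fun u => (cs u : ℕ)) (fun u => dec P (cs u : ℕ)) hdec
  have hrep : ∀ (i : Fin n) (t : Fin P.T), ∃ m : ℤ, rows i t = ((s i t).val : ℚ) / h + m := fun i t =>
    exists_deriveR_eq_repQ_sG hh hhB hδ hδK (hacc _) (hacc _) t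
  have hden : ∀ (i : Fin n) (t : Fin P.T), (rows i t).den ∣ h := by
    intro i t
    obtain ⟨m, hm⟩ := hrep i t
    rw [hm, Rat.add_intCast_den]
    exact den_repQ_dvd (s i) t
  set N := lcmDen (List.ofFn fun i => (List.range P.T).map (rows i)) with hN
  have hNh : N ∣ h := lcmDen_ofFn_dvd rows hden
  have hN0 : N ≠ 0 := fun h0 => NeZero.ne h (Nat.eq_zero_of_zero_dvd (h0 ▸ hNh))
  have hNB : N ≤ P.B := (Nat.le_of_dvd (Nat.pos_of_ne_zero (NeZero.ne h)) hNh).trans hhB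
  rw [PostParams.postOutC, hpr, if_pos hNB, PostParams.postOutR, hpr, ← hN,
    subgroupOrderPure_natRows_eq_card rows s hrep hNh hN0 (fun i t => den_dvd_lcmDen_ofFn rows i t)]
  -- `closure (range s) = annih h Λ` has `h` elements
  have hrange : Set.range s = (annih h Λ).subtype '' Set.range (fun i : Fin n => sG P Λ μ' δ hh (cs (pa n i)) (cs (pb n i))) := by
    rw [← Set.range_comp]; rfl
  rw [hrange, ← AddMonoidHom.map_closure, hgen, AddSubgroup.card_map_of_injective (AddSubgroup.subtype_injective _),
    AddSubgroup.card_top]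
  exact card_annih hh

end Correct

/-! ### The probability estimate -/

section Prob

variable {P : PostParams} {Λ : AddSubgroup (Fin P.T → ℤ)} [Λ.FiniteIndex] {μ' : Fin P.T → ℝ} {δ ε₁ ε₂ ε₃ : ℝ}
  {w w₁ : ℕ → ℝ} {h : ℕ} [NeZero h]

/-- The product law of the `2n` units with outcome law `w` on `Fin Q`. [cite: Hallgren2005, §4; Kitaev1995, §4] -/
def lawOf (w : ℕ → ℝ) (m Q : ℕ) : (u : Fin m) → Fin Q → ℝ := fun _ x => w x

omit [Λ.FiniteIndex] [NeZero h] in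
/-- `lawOf` is a product of probability vectors. [cite: Hallgren2005, §4; Kitaev1995, §4] -/
theorem isProbVec_lawOf (hw : ∀ c, 0 ≤ w c) {Q : ℕ} (hsum : ∑ c ∈ range Q, w c = 1) (m : ℕ) :
    PeriodFinding.IsProbVec (lawOf w m Q) :=
  ⟨fun _ x => hw x, fun u => by
    show ∑ x : Fin Q, w x = 1
    rw [Fin.sum_univ_eq_sum_range, hsum]⟩

/-- **The single-pair bound**: the `w ⊗ w`-probability that both outcomes are accurate and the combination lands in a proper
subgroup `H` is `≤ (1+ε₂)²/2 · (1+ε₃)²`. [cite: Hallgren2005, §4] -/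
theorem pair_prob_le (hh : Λ.index = h) (hhB : h ≤ P.B) (hδK : (4 * (P.K₀ : ℝ) + 2) * δ * (P.B : ℝ) ^ 2 < 1)
    (hδ : 0 ≤ δ) (hε₂ : 0 ≤ ε₂) (hw : ∀ c, 0 ≤ w c) (hsum : ∑ c ∈ range (2 ^ P.Lq), w c = 1)
    (hdiff : ∑ c ∈ range (2 ^ P.Lq), |w c - w₁ c| ≤ ε₃) (hlaw : UnitSamplingLaw P Λ μ' δ ε₁ ε₂ w₁)
    (H : AddSubgroup (annih h Λ)) (hH : H ≠ ⊤) :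
    ∑ x : Fin (2 ^ P.Lq), ∑ y : Fin (2 ^ P.Lq), (if ((x : ℕ), (y : ℕ)) ∈ pairEvSet P Λ μ' δ hh H then w x * w y else 0) ≤
      (1 + ε₂) ^ 2 / 2 * (1 + ε₃) ^ 2 := by
  haveI : Fintype (annih h Λ) := Fintype.ofFinite _
  have hcard : Fintype.card (annih h Λ) = h := by rw [← Nat.card_eq_fintype_card, card_annih hh]
  have h1 : 1 ≤ h := Nat.pos_of_ne_zero (NeZero.ne h)
  -- `2δ < 1/h`
  have hsep : 2 * δ < 1 / (h : ℝ) := by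
    have hB1 : (1 : ℝ) ≤ P.B := by exact_mod_cast h1.trans hhB
    have hhB' : (h : ℝ) ≤ P.B := by exact_mod_cast hhB
    have hK : (0 : ℝ) ≤ 4 * P.K₀ * δ * (P.B : ℝ) ^ 2 := by positivity
    have h2 : 2 * δ * (P.B : ℝ) ^ 2 < 1 := by nlinarith
    have e1 : 2 * δ * (h : ℝ) ≤ 2 * δ * P.B := mul_le_mul_of_nonneg_left hhB' (by linarith)
    have e2 : 2 * δ * (P.B : ℝ) ≤ 2 * δ * (P.B : ℝ) ^ 2 := by
      have : (P.B : ℝ) ≤ (P.B : ℝ) ^ 2 := by nlinarith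
      exact mul_le_mul_of_nonneg_left this (by linarith)
    rw [lt_div_iff₀ (by exact_mod_cast h1)]
    linarith
  set HF : Finset (annih h Λ) := univ.filter (· ∈ H) with hHF
  have hHF2 : 2 * HF.card ≤ Fintype.card (annih h Λ) := by
    have h2 := Hallgren2005.two_mul_card_le_of_ne_top hH
    rw [Nat.card_eq_fintype_card (α := annih h Λ)] at h2
    convert h2 using 2
    rw [hHF, Nat.card_eq_fintype_card, Fintype.card_subtype]
  have key := sum_pair_event_le (univ : Finset (Fin (2 ^ P.Lq))) (fun x => (x : ℕ) ∈ AccAll P Λ μ' δ)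
    (fun x => klab P x) (fun x => glab P Λ μ' δ hh x) (fun x => w x) (fun x => w₁ x) cf (ε₂ := ε₂) (ε₃ := ε₃) HF
    (fun x => hw x) (fun x => hlaw.1 x) (by rw [Fin.sum_univ_eq_sum_range, hsum])
    (by rw [Fin.sum_univ_eq_sum_range (fun c => |w c - w₁ c|)]; exact hdiff) ?_ (fun k k' => gcd_coefs _ _) hHF2 hε₂
  · refine le_trans (le_of_eq (sum_congr rfl fun x _ => sum_congr rfl fun y _ => if_congr ?_ rfl rfl)) key
    simp only [pairEvSet, Set.mem_setOf_eq, sG, hHF, mem_filter, mem_univ, true_and]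
  · intro kk g
    have hrepd : repQ h (g : Fin P.T → ZMod h) ∈ dualReps P.T Λ := ⟨repQ_nonneg_lt _, repQ_pairs_int g.2⟩
    rw [hcard]
    calc ∑ a ∈ univ.filter (fun a : Fin (2 ^ P.Lq) => (a : ℕ) ∈ AccAll P Λ μ' δ ∧ klab P a = kk ∧ glab P Λ μ' δ hh a = g), w₁ a
        = ∑ c ∈ (range (2 ^ P.Lq)).filter (fun c => c ∈ Acc P μ' δ kk (repQ h (g : Fin P.T → ZMod h))), w₁ c := by
          rw [sum_filter, sum_filter, ← Fin.sum_univ_eq_sum_range]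
          exact sum_congr rfl fun a _ => if_congr (mem_Acc_repQ_iff hh hsep kk g a).symm rfl rfl
      _ ≤ (1 + ε₂) / (Λ.index : ℝ) *
          ∑ c ∈ (range (2 ^ P.Lq)).filter (fun c => ∃ ξ' ∈ dualReps P.T Λ, c ∈ Acc P μ' δ kk ξ'), w₁ c := hlaw.2.2 kk _ hrepd
      _ = (1 + ε₂) / (h : ℝ) * ∑ a ∈ univ.filter (fun a : Fin (2 ^ P.Lq) => (a : ℕ) ∈ AccAll P Λ μ' δ ∧ klab P a = kk), w₁ a := by
          rw [sum_filter, sum_filter, ← Fin.sum_univ_eq_sum_range, hh]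
          congr 1
          exact sum_congr rfl fun a _ => if_congr (exists_mem_Acc_iff hh hsep kk a) rfl rfl

/-- **The failure bound**: `P(success) ≥ 1 − 2n(ε₁+ε₃) − #Sub(G) · ((1+ε₂)²/2 (1+ε₃)²)^n`. [cite: Hallgren2005, §4; Kitaev1995, §4] -/
theorem success_ge (hh : Λ.index = h) (hhB : h ≤ P.B) (hδK : (4 * (P.K₀ : ℝ) + 2) * δ * (P.B : ℝ) ^ 2 < 1)
    (hδ : 0 ≤ δ) (hε₂ : 0 ≤ ε₂) (hw : ∀ c, 0 ≤ w c) (hsum : ∑ c ∈ range (2 ^ P.Lq), w c = 1)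
    (hdiff : ∑ c ∈ range (2 ^ P.Lq), |w c - w₁ c| ≤ ε₃) (hlaw : UnitSamplingLaw P Λ μ' δ ε₁ ε₂ w₁) (n : ℕ)
    [Fintype (AddSubgroup (annih h Λ))] :
    1 - (2 * n * (ε₁ + ε₃) + Nat.card (AddSubgroup (annih h Λ)) * ((1 + ε₂) ^ 2 / 2 * (1 + ε₃) ^ 2) ^ n) ≤
      ∑ cs : Fin (2 * n) → Fin (2 ^ P.Lq),
        if P.postOutC (List.ofFn fun u => ((cs u : ℕ))) = Λ.index then ∏ u, w (cs u) else 0 := by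
  set Q := 2 ^ P.Lq with hQ
  set μ := lawOf w (2 * n) Q with hμ
  have hpv : PeriodFinding.IsProbVec μ := isProbVec_lawOf hw hsum (2 * n)
  -- events
  set Succ : Finset (Fin (2 * n) → Fin Q) := univ.filter fun cs => P.postOutC (List.ofFn fun u => ((cs u : ℕ))) = Λ.index
    with hSucc
  set Bad : Finset (Fin (2 * n) → Fin Q) := univ.filter fun cs => ∃ u, (cs u : ℕ) ∉ AccAll P Λ μ' δ with hBad
  set EH : AddSubgroup (annih h Λ) → Finset (Fin (2 * n) → Fin Q) := fun H => univ.filter fun cs => ∀ i : Fin n,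
    ((cs (pa n i) : ℕ), (cs (pb n i) : ℕ)) ∈ pairEvSet P Λ μ' δ hh H with hEH
  set Hs : Finset (AddSubgroup (annih h Λ)) := univ.filter fun H => H ≠ ⊤ with hHs
  -- the target is `prob μ Succ`
  have htarget : (∑ cs : Fin (2 * n) → Fin Q, if P.postOutC (List.ofFn fun u => ((cs u : ℕ))) = Λ.index
      then ∏ u, w (cs u) else 0) = PeriodFinding.prob μ Succ := by
    rw [PeriodFinding.prob, hSucc, sum_filter]; rfl
  rw [htarget]
  -- covering of the failure event
  have hcover : Succᶜ ⊆ Bad ∪ Hs.biUnion EH := by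
    intro cs hcs
    rw [mem_compl, hSucc, mem_filter, not_and] at hcs
    have hfail := hcs (mem_univ _)
    by_cases hb : ∃ u, (cs u : ℕ) ∉ AccAll P Λ μ' δ
    · exact mem_union_left _ (by rw [hBad, mem_filter]; exact ⟨mem_univ _, hb⟩)
    · push Not at hb
      have hgen : AddSubgroup.closure (Set.range fun i : Fin n => sG P Λ μ' δ hh (cs (pa n i)) (cs (pb n i))) ≠ ⊤ :=
        fun hg => hfail (by rw [postOutC_eq_of_generate hh hhB hδ hδK cs hb hg, hh])
      refine mem_union_right _ (mem_biUnion.2 ⟨_, by rw [hHs, mem_filter]; exact ⟨mem_univ _, hgen⟩, ?_⟩)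
      rw [hEH, mem_filter]
      exact ⟨mem_univ _, fun i => ⟨hb _, hb _, AddSubgroup.subset_closure ⟨i, rfl⟩⟩⟩
  -- the bad units
  have hbad : PeriodFinding.prob μ Bad ≤ 2 * n * (ε₁ + ε₃) := by
    have hunit : ∀ u : Fin (2 * n), PeriodFinding.prob μ (univ.filter fun cs : Fin (2 * n) → Fin Q =>
        cs u ∈ (univ : Finset (Fin Q)).filter fun x : Fin Q => (x : ℕ) ∉ AccAll P Λ μ' δ) ≤ ε₁ + ε₃ := by
      intro u
      rw [PeriodFinding.prob_filter_apply hpv]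
      have e : (∑ x ∈ (univ : Finset (Fin Q)).filter (fun x : Fin Q => (x : ℕ) ∉ AccAll P Λ μ' δ), μ u x) =
          ∑ c ∈ (range Q).filter (fun c => c ∉ AccAll P Λ μ' δ), w c := by
        rw [sum_filter, sum_filter]
        exact Fin.sum_univ_eq_sum_range (fun c => if c ∉ AccAll P Λ μ' δ then w c else 0) Q
      rw [e]
      calc ∑ c ∈ (range Q).filter (fun c => c ∉ AccAll P Λ μ' δ), w c
          ≤ ∑ c ∈ (range Q).filter (fun c => c ∉ AccAll P Λ μ' δ), (w₁ c + |w c - w₁ c|) :=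
            sum_le_sum fun c _ => by linarith [le_abs_self (w c - w₁ c)]
        _ = ∑ c ∈ (range Q).filter (fun c => c ∉ AccAll P Λ μ' δ), w₁ c +
              ∑ c ∈ (range Q).filter (fun c => c ∉ AccAll P Λ μ' δ), |w c - w₁ c| := sum_add_distrib
        _ ≤ ε₁ + ε₃ := add_le_add hlaw.2.1
            ((sum_le_sum_of_subset_of_nonneg (filter_subset _ _) fun c _ _ => abs_nonneg _).trans hdiff)
    have hsub : Bad ⊆ (univ : Finset (Fin (2 * n))).biUnion fun u => univ.filter fun cs : Fin (2 * n) → Fin Q =>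
        cs u ∈ (univ : Finset (Fin Q)).filter fun x : Fin Q => (x : ℕ) ∉ AccAll P Λ μ' δ := by
      intro cs hcs
      rw [hBad, mem_filter] at hcs
      obtain ⟨u, hu⟩ := hcs.2
      exact mem_biUnion.2 ⟨u, mem_univ _, by rw [mem_filter]; exact ⟨mem_univ _, by rw [mem_filter]; exact ⟨mem_univ _, hu⟩⟩⟩
    calc PeriodFinding.prob μ Bad ≤ _ := PeriodFinding.prob_mono hpv hsub
      _ ≤ ∑ u : Fin (2 * n), PeriodFinding.prob μ (univ.filter fun cs : Fin (2 * n) → Fin Q =>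
          cs u ∈ (univ : Finset (Fin Q)).filter fun x : Fin Q => (x : ℕ) ∉ AccAll P Λ μ' δ) := PeriodFinding.prob_biUnion_le hpv _ _
      _ ≤ ∑ _u : Fin (2 * n), (ε₁ + ε₃) := sum_le_sum fun u _ => hunit u
      _ = 2 * n * (ε₁ + ε₃) := by rw [sum_const, card_univ, Fintype.card_fin, nsmul_eq_mul]; push_cast; ring
  -- each generation-failure event
  set q₀ : ℝ := (1 + ε₂) ^ 2 / 2 * (1 + ε₃) ^ 2 with hq₀
  have hEHle : ∀ H ∈ Hs, PeriodFinding.prob μ (EH H) ≤ q₀ ^ n := by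
    intro H hHm
    have hHne : H ≠ ⊤ := (mem_filter.1 hHm).2
    have hpair : ∀ i : Fin n, PeriodFinding.prob μ (univ.filter fun cs : Fin (2 * n) → Fin Q =>
        ((cs (pa n i) : ℕ), (cs (pb n i) : ℕ)) ∈ pairEvSet P Λ μ' δ hh H) ≤ q₀ := by
      intro i
      have hne : pa n i ≠ pb n i := fun e => (disjointPairs_pa_pb n).a_ne_b i i e
      rw [PeriodFinding.prob, sum_filter]
      have e : (∑ cs : Fin (2 * n) → Fin Q, if ((cs (pa n i) : ℕ), (cs (pb n i) : ℕ)) ∈ pairEvSet P Λ μ' δ hh H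
            then PeriodFinding.pw μ cs else 0) =
          ∑ cs : Fin (2 * n) → Fin Q, PeriodFinding.pw μ cs *
            (fun x y : Fin Q => if ((x : ℕ), (y : ℕ)) ∈ pairEvSet P Λ μ' δ hh H then (1 : ℝ) else 0) (cs (pa n i)) (cs (pb n i)) :=
        sum_congr rfl fun cs _ => by simp only []; split_ifs <;> simp
      rw [e, PeriodFinding.sum_pw_mul_apply₂ hpv hne (fun x y : Fin Q => if ((x : ℕ), (y : ℕ)) ∈ pairEvSet P Λ μ' δ hh H then (1 : ℝ) else 0)]
      calc ∑ x : Fin Q, ∑ y : Fin Q, μ (pa n i) x * μ (pb n i) y * (if ((x : ℕ), (y : ℕ)) ∈ pairEvSet P Λ μ' δ hh H then (1 : ℝ) else 0)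
          = ∑ x : Fin Q, ∑ y : Fin Q, (if ((x : ℕ), (y : ℕ)) ∈ pairEvSet P Λ μ' δ hh H then w x * w y else 0) :=
            sum_congr rfl fun x _ => sum_congr rfl fun y _ => by split_ifs <;> simp [hμ, lawOf]
        _ ≤ q₀ := pair_prob_le hh hhB hδK hδ hε₂ hw hsum hdiff hlaw H hHne
    have hq0 : 0 ≤ q₀ := by positivity
    have hprod := PeriodFinding.prob_forall_not_eq_prod hpv (disjointPairs_pa_pb n)
      (fun _ (x y : Fin Q) => ¬ ((x : ℕ), (y : ℕ)) ∈ pairEvSet P Λ μ' δ hh H) univ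
    have hEq : PeriodFinding.prob μ (EH H) = ∏ i ∈ (univ : Finset (Fin n)), (1 - PeriodFinding.prob μ
        (univ.filter fun cs : Fin (2 * n) → Fin Q => ¬ ((cs (pa n i) : ℕ), (cs (pb n i) : ℕ)) ∈ pairEvSet P Λ μ' δ hh H)) := by
      convert hprod using 3
      simp
    have hfac : ∀ i ∈ (univ : Finset (Fin n)), 1 - PeriodFinding.prob μ (univ.filter fun cs : Fin (2 * n) → Fin Q =>
        ¬ ((cs (pa n i) : ℕ), (cs (pb n i) : ℕ)) ∈ pairEvSet P Λ μ' δ hh H) =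
        PeriodFinding.prob μ (univ.filter fun cs : Fin (2 * n) → Fin Q => ((cs (pa n i) : ℕ), (cs (pb n i) : ℕ)) ∈ pairEvSet P Λ μ' δ hh H) := by
      intro i _
      have hc := PeriodFinding.prob_compl hpv
        (univ.filter fun cs : Fin (2 * n) → Fin Q => ((cs (pa n i) : ℕ), (cs (pb n i) : ℕ)) ∈ pairEvSet P Λ μ' δ hh H)
      rw [compl_filter] at hc
      linarith
    rw [hEq, prod_congr rfl hfac]
    calc ∏ i : Fin n, PeriodFinding.prob μ (univ.filter fun cs : Fin (2 * n) → Fin Q =>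
          ((cs (pa n i) : ℕ), (cs (pb n i) : ℕ)) ∈ pairEvSet P Λ μ' δ hh H)
        ≤ ∏ _i : Fin n, q₀ := prod_le_prod (fun i _ => PeriodFinding.prob_nonneg hpv _) fun i _ => hpair i
      _ = q₀ ^ n := by rw [prod_const, card_univ, Fintype.card_fin]
  -- assemble
  have hHs : (Hs.card : ℝ) ≤ Nat.card (AddSubgroup (annih h Λ)) := by
    rw [Nat.card_eq_fintype_card]
    exact_mod_cast (card_filter_le _ _).trans (card_univ (α := AddSubgroup (annih h Λ))).le
  have hq0' : 0 ≤ q₀ ^ n := by positivity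
  have hfailure : PeriodFinding.prob μ Succᶜ ≤ 2 * n * (ε₁ + ε₃) + Nat.card (AddSubgroup (annih h Λ)) * q₀ ^ n := by
    calc PeriodFinding.prob μ Succᶜ ≤ PeriodFinding.prob μ (Bad ∪ Hs.biUnion EH) := PeriodFinding.prob_mono hpv hcover
      _ ≤ PeriodFinding.prob μ Bad + PeriodFinding.prob μ (Hs.biUnion EH) := PeriodFinding.prob_union_le hpv _ _
      _ ≤ 2 * n * (ε₁ + ε₃) + ∑ H ∈ Hs, PeriodFinding.prob μ (EH H) := add_le_add hbad (PeriodFinding.prob_biUnion_le hpv _ _)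
      _ ≤ 2 * n * (ε₁ + ε₃) + ∑ _H ∈ Hs, q₀ ^ n := by gcongr with H hH; exact hEHle H hH
      _ ≤ 2 * n * (ε₁ + ε₃) + Nat.card (AddSubgroup (annih h Λ)) * q₀ ^ n := by
          rw [sum_const, nsmul_eq_mul]
          exact add_le_add le_rfl (mul_le_mul_of_nonneg_right hHs hq0')
  have hcompl := PeriodFinding.prob_compl hpv Succ
  linarith

end Prob

/-! ### The registered statement -/

/-- (REGISTERED SIGNATURE — do not change.) **S5b-P7 `stub_classPost`**: the exact-modes / coprime-pairing post-processing
succeeds (`ClaimPost`, `Literature/Computability/Cryptography/CubicClassSamplingSpecs.lean`). [cite: Hallgren2005, §4; Kitaev1995, §4] -/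
theorem stub_classPost : ClaimPost := by
  intro P Λ _ μ' δ ε₁ ε₂ ε₃ w w₁ n hT hidx hδK hδ hε₁ hε₂ hε₃ hw hsum hdiff hlaw
  set h := Λ.index with hhdef
  haveI : NeZero h := ⟨AddSubgroup.FiniteIndex.index_ne_zero⟩
  haveI : Fintype (annih h Λ) := Fintype.ofFinite _
  haveI : Fintype (AddSubgroup (annih h Λ)) := @Fintype.ofFinite _ Hallgren2005.finite_addSubgroup
  have hcardG : Fintype.card (annih h Λ) = h := by rw [← Nat.card_eq_fintype_card, card_annih rfl]
  have h1 : 1 ≤ h := Nat.pos_of_ne_zero (NeZero.ne h)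
  set q : ℝ := (1 + ε₂) ^ 2 / 2 + 3 * (ε₁ + ε₃) with hq
  set q₀ : ℝ := (1 + ε₂) ^ 2 / 2 * (1 + ε₃) ^ 2 with hq₀
  set L : ℕ := Nat.log 2 P.B + 2 with hL
  have hnonneg : 0 ≤ ∑ cs : Fin (2 * n) → Fin (2 ^ P.Lq),
      (if P.postOutC (List.ofFn fun u => ((cs u : ℕ))) = Λ.index then ∏ u, w (cs u) else 0) :=
    sum_nonneg fun cs _ => by split_ifs; exacts [prod_nonneg fun u _ => hw _, le_rfl]
  have hBL : (1 : ℝ) ≤ ((P.B : ℝ) + 1) ^ L := one_le_pow₀ (by linarith [(Nat.cast_nonneg P.B : (0 : ℝ) ≤ P.B)])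
  by_cases hq1 : 1 ≤ q
  · -- the claimed bound is `≤ 0`
    have hqn : (1 : ℝ) ≤ q ^ n := one_le_pow₀ hq1
    have hn0 : (0 : ℝ) ≤ 2 * n * (ε₁ + ε₃) := by positivity
    nlinarith
  · push Not at hq1
    have hq0 : 0 ≤ q₀ := by positivity
    have hε₃1 : ε₃ ≤ 1 := by nlinarith [sq_nonneg (1 + ε₂)]
    have hκ : (1 + ε₂) ^ 2 ≤ 2 := by nlinarith
    have hq₀q : q₀ ≤ q := (half_sq_mul_sq_le hκ hε₃ hε₃1).trans (by rw [hq]; nlinarith)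
    have hmain := success_ge (P := P) (Λ := Λ) (μ' := μ') rfl hidx hδK hδ hε₂ hw hsum hdiff hlaw n
    -- `#Sub(G) ≤ (B+1)^(log₂ B + 2)`
    have hsubs : (Nat.card (AddSubgroup (annih h Λ)) : ℝ) ≤ ((P.B : ℝ) + 1) ^ L := by
      have h0 := Hallgren2005.card_addSubgroup_le (H := annih h Λ)
      rw [hcardG] at h0
      have h2 : (h + 1) ^ Nat.log 2 h ≤ (P.B + 1) ^ L :=
        (Nat.pow_le_pow_left (by omega) _).trans (Nat.pow_le_pow_right (by omega) ((Nat.log_mono_right hidx).trans (by omega)))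
      exact_mod_cast h0.trans h2
    have hpow : q₀ ^ n ≤ q ^ n := pow_le_pow_left₀ hq0 hq₀q n
    have : (Nat.card (AddSubgroup (annih h Λ)) : ℝ) * q₀ ^ n ≤ ((P.B : ℝ) + 1) ^ L * q ^ n :=
      mul_le_mul hsubs hpow (pow_nonneg hq0 n) (by positivity)
    linarith

end Literature.Computability.Cryptography.CubicClassSampling.LinnikStubs

end Part3

/-! ## Part 4 — the three EXACT discharges -/

namespace Literature.Computability.Cryptography.CubicClassSampling

/-- **The named fact `ClaimSamplingLaw` (P6) HOLDS** — EXACT-name discharge by `LinnikStubs.stub_classSamplingLaw`; Literature-side twin of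
the Summits-side `Summit.QuantumAdvantage.QuantumAdvantage.Theorems.LinnikCubicClassGroups.stub_classSamplingLaw`. [cite: Hallgren2005, §4] -/
theorem ClaimSamplingLaw_holds : ClaimSamplingLaw :=
  LinnikStubs.stub_classSamplingLaw

/-- **The named fact `ClaimTableFP` HOLDS** — EXACT-name discharge by `LinnikStubs.stub_classTableProg`; Literature-side twin of the
Summits-side `Summit.QuantumAdvantage.QuantumAdvantage.Theorems.LinnikCubicClassGroups.stub_classTableProg`. [cite: Hallgren2005, §4] -/
theorem ClaimTableFP_holds : ClaimTableFP :=
  LinnikStubs.stub_classTableProg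

/-- **The named fact `ClaimPost` (P7) HOLDS** — EXACT-name discharge by `LinnikStubs.stub_classPost`; Literature-side twin of the
Summits-side `Summit.QuantumAdvantage.QuantumAdvantage.Theorems.LinnikCubicClassGroups.stub_classPost`. [cite: Hallgren2005, §4] -/
theorem ClaimPost_holds : ClaimPost :=
  LinnikStubs.stub_classPost

end Literature.Computability.Cryptography.CubicClassSampling

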